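import Literature.Probability.RandomGraphs.PlantedClique
import Mathlib.Data.List.Sort
import Mathlib.Data.List.Sublists
import Mathlib.Data.Prod.Lex
import HarnessLib

/-!
# The Alon–Krivelevich–Sudakov algorithm as a functional program

The planted-clique recovery algorithm of Alon–Krivelevich–Sudakov 1998 (Algorithm B, §2.3, with
Algorithm A, §2.1, as its subroutine) written as a total functional program on the machine-level
data of `PlantedClique.lean`: the input is the pair `(n, w)` of the (unary) size and the edge
string `w = encodeEdgeVec x` (bits of the pairs `i < j` in lexicographic order), vertices are
naturals `< n`, and the output is the `n`-bit indicator string read by `decodeVertexSet`.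

Differences from the printed algorithm, all immaterial to its analysis and forced by the setting
(the algorithm is ONE program, which is not told `k`):
* the spectral step is `t = n` rounds of exact integer power iteration on the centred `±1`
  adjacency matrix of the common neighbourhood (column `j`, for every `j`), in place of "the
  second eigenvector of `A`" (AKS, §2.1 step 1, computed "by [19]" in floating point);
* every clique size `k' ≤ n` and every seed tuple of the fixed length `s` is tried, and among
  all candidate sets that are cliques one of maximum size is returned (AKS, Algorithm B, steps
  2–6, return the first `Q_S ∪ S` that is a `k`-clique).

This file contains the program (namespace `AKSProg`) and its list-level semantics (membership
and structural lemmas, the selection of the best candidate, and the order-theoretic content of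
`topPositions`: the selected positions dominate the others in absolute value); the arithmetic of
the edge string and the linear algebra of `powerCol` are in `PlantedCliqueProgramMatrix.lean`,
the polynomial-time realisation in `PlantedCliqueProgramFP.lean`. Mathlib's `List.sublistsLen`
(seed tuples) and `List.insertionSort` (selection) are used as they are.

## References

* N. Alon, M. Krivelevich, B. Sudakov, *Finding a large hidden clique in a random graph*, Random
  Structures Algorithms 13 (1998) 457–466, §2.1 (Algorithm A), §2.3 (Algorithm B)
  [AlonKrivelevichSudakov1998].
-/

namespace Literature.Probability.RandomGraphs.PlantedClique

-- The AKS program (grouping namespace `AKSProg`); all functions take the size `n` and the edge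
-- string `w`.
namespace AKSProg

open List

/-! ### The program -/

/-- Offset of row `i` of the edge string: the pairs `(i', j)`, `i' < i`, come first, `n - 1 - i'`
of them for each `i'`. [folklore] -/
def rowOffset (n i : ℕ) : ℕ := ((List.range i).map fun i' => n - 1 - i').sum

/-- The adjacency bit of the pair `{i, j}` read off the edge string (`false` on the diagonal and
out of range). [cite: AlonKrivelevichSudakov1998, §2 (input `G = (V,E)`)] -/
def adj (n : ℕ) (w : List Bool) (i j : ℕ) : Bool :=
  if i < j then w.getD (rowOffset n i + (j - i - 1)) false
  else if j < i then w.getD (rowOffset n j + (i - j - 1)) false else false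

/-- The seed sets of Algorithm B: the `s`-element sublists of `[0, …, n-1]` (Mathlib's
`List.sublistsLen`; each is strictly increasing). [cite: AlonKrivelevichSudakov1998, §2.3 (Algorithm B, step 2)] -/
def tuples (n s : ℕ) : List (List ℕ) := (List.range n).sublistsLen s

/-- The common neighbourhood `N*(S)` of a seed tuple, as an increasing list of vertices.
[cite: AlonKrivelevichSudakov1998, §2.3 (`N*(S)`)] -/
def commonNbrs (n : ℕ) (w : List Bool) (t : List ℕ) : List ℕ :=
  (List.range n).filter fun v => !decide (v ∈ t) && t.all fun u => adj n w v u

/-- Entry of the centred `±1` adjacency matrix `B = 2A - J + I` between two vertices.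
[cite: AlonKrivelevichSudakov1998, §2.1 (the adjacency matrix `A`)] -/
def sgnEntry (n : ℕ) (w : List Bool) (a b : ℕ) : ℤ :=
  if a = b then 0 else if adj n w a b then 1 else -1

/-- One round of power iteration on the vertex list `L`: `y ↦ B_L y` (positions index `L`).
[cite: AlonKrivelevichSudakov1998, §2.1 (step 1)] -/
def matVec (n : ℕ) (w : List Bool) (L : List ℕ) (y : List ℤ) : List ℤ :=
  L.map fun a => ((L.zip y).map fun p => sgnEntry n w a p.1 * p.2).sum

/-- The `j`-th basis vector of length `m`. [folklore] -/
def basisVec (m j : ℕ) : List ℤ := (List.range m).map fun a => if a = j then 1 else 0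

/-- `t` rounds of power iteration from the `j`-th basis vector: column `j` of `B_Lᵗ`.
[cite: AlonKrivelevichSudakov1998, §2.1 (step 1)] -/
def powerCol (n : ℕ) (w : List Bool) (L : List ℕ) (j t : ℕ) : List ℤ :=
  (List.range t).foldl (fun y _ => matVec n w L y) (basisVec L.length j)

/-- The order of Algorithm A, step 2, as a total preorder on keys `(|value|, position)`: larger
absolute value first, ties by position (`keyLE p q`: `p` comes no later than `q`).
[cite: AlonKrivelevichSudakov1998, §2.1 (step 2: "equalities are broken arbitrarily")] -/
def keyLE (p q : ℤ × ℕ) : Bool :=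
  decide (q.1 < p.1) || (decide (p.1 = q.1) && decide (p.2 ≤ q.2))

/-- The positions of the `k'` largest coordinates of `y` in absolute value (Algorithm A, step 2:
the set `W`), by insertion sort of the keys. [cite: AlonKrivelevichSudakov1998, §2.1 (step 2, the set `W`)] -/
def topPositions (y : List ℤ) (k' : ℕ) : List ℕ :=
  (((y.mapIdx fun a v => (|v|, a)).insertionSort fun p q => keyLE p q = true).take k').map Prod.snd

/-- The clean-up step on positions of `L`: positions with at least `3k'/4` neighbours among the
positions `W` (Algorithm A, step 2: the set `Q`). [cite: AlonKrivelevichSudakov1998, §2.1 (step 2, the set `Q`)] -/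
def cleanup (n : ℕ) (w : List Bool) (L : List ℕ) (W : List ℕ) (k' : ℕ) : List ℕ :=
  (List.range L.length).filter fun a =>
    decide (3 * k' ≤ 4 * (W.filter fun b => adj n w (L.getD a 0) (L.getD b 0)).length)

/-- The candidate set `Q_S ∪ S` for seed tuple `t`, column `j` and size guess `k'`
(Algorithm B, steps 3–4). [cite: AlonKrivelevichSudakov1998, §2.3 (Algorithm B, steps 3–4)] -/
def candidate (n : ℕ) (w : List Bool) (t : List ℕ) (j k' : ℕ) : List ℕ :=
  ((cleanup n w (commonNbrs n w t)
      (topPositions (powerCol n w (commonNbrs n w t) j n) k') k').map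
    fun a => (commonNbrs n w t).getD a 0) ++ t

/-- The clique test for a vertex list (all pairs of distinct entries adjacent).
[cite: AlonKrivelevichSudakov1998, §2.3 (Algorithm B, step 4)] -/
def isClique (n : ℕ) (w : List Bool) (C : List ℕ) : Bool :=
  C.all fun a => C.all fun b => decide (a = b) || adj n w a b

/-- Keep the better of the current best and a new candidate: a clique strictly longer wins.
[cite: AlonKrivelevichSudakov1998, §2.3 (Algorithm B, steps 4–6)] -/
def better (n : ℕ) (w : List Bool) (best C : List ℕ) : List ℕ :=
  if isClique n w C && decide (best.length < C.length) then C else best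

/-- All candidates: every seed `s`-tuple, every column `j < n`, every size `k' ∈ [1, n]`.
[cite: AlonKrivelevichSudakov1998, §2.3 (Algorithm B, step 2)] -/
def candidates (n s : ℕ) (w : List Bool) : List (List ℕ) :=
  (((tuples n s).map fun t => ((List.range n).map fun j =>
    (List.range n).map fun k' => candidate n w t j (k' + 1)).flatten)).flatten

/-- The result: a largest clique among the candidates (the first one found).
[cite: AlonKrivelevichSudakov1998, §2.3 (Algorithm B, step 6)] -/
def best (n s : ℕ) (w : List Bool) : List ℕ := (candidates n s w).foldl (better n w) []

/-- **The AKS program** with seed length `s`: on `(n, w)` output the `n` indicator bits of `best`.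
[cite: AlonKrivelevichSudakov1998, §2.3 (Algorithm B)] -/
def output (s : ℕ) (p : ℕ × List Bool) : List Bool :=
  (List.range p.1).map fun v => decide (v ∈ best p.1 s p.2)

/-! ### List-level semantics -/

/-- Seed tuples are the length-`s` sublists of `[0, …, n-1]`. [folklore] -/
theorem mem_tuples_iff {n s : ℕ} {t : List ℕ} :
    t ∈ tuples n s ↔ t.Sublist (List.range n) ∧ t.length = s := List.mem_sublistsLen

/-- A seed tuple is strictly increasing, duplicate-free, with entries `< n`. [folklore] -/
theorem tuple_props {n s : ℕ} {t : List ℕ} (ht : t ∈ tuples n s) :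
    t.Pairwise (· < ·) ∧ t.Nodup ∧ (∀ v ∈ t, v < n) ∧ t.length = s := by
  obtain ⟨hsub, hlen⟩ := mem_tuples_iff.1 ht
  exact ⟨List.pairwise_lt_range.sublist hsub, hsub.nodup List.nodup_range,
    fun v hv => List.mem_range.1 (hsub.subset hv), hlen⟩

/-- The sorted list of an `s`-set of vertices `< n` is a seed tuple. [folklore] -/
theorem sort_mem_tuples {n s : ℕ} {A : Finset ℕ} (hA : A.card = s) (hAn : ∀ v ∈ A, v < n) :
    A.sort (· ≤ ·) ∈ tuples n s := by
  refine mem_tuples_iff.2 ⟨?_, by rw [Finset.length_sort, hA]⟩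
  have heq : A.sort (· ≤ ·) = (List.range n).filter fun v => decide (v ∈ A) := by
    refine (Finset.sortedLT_sort A).eq_of_mem_iff ((List.sortedLT_range n).pairwise.filter _).sortedLT
      fun v => ?_
    rw [Finset.mem_sort, List.mem_filter, List.mem_range, decide_eq_true_eq]
    exact ⟨fun h => ⟨hAn v h, h⟩, fun h => h.2⟩
  rw [heq]
  exact List.filter_sublist

/-- Membership in the common neighbourhood list. [folklore] -/
theorem mem_commonNbrs_iff (n : ℕ) (w : List Bool) (t : List ℕ) (v : ℕ) :
    v ∈ commonNbrs n w t ↔ v < n ∧ v ∉ t ∧ ∀ u ∈ t, adj n w v u = true := by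
  simp [commonNbrs, List.all_eq_true]

/-- The common neighbourhood list is strictly increasing (hence duplicate-free). [folklore] -/
theorem commonNbrs_sorted (n : ℕ) (w : List Bool) (t : List ℕ) :
    (commonNbrs n w t).Pairwise (· < ·) :=
  (List.sortedLT_range n).pairwise.filter _

/-- The common neighbourhood list has no duplicates. [folklore] -/
theorem commonNbrs_nodup (n : ℕ) (w : List Bool) (t : List ℕ) : (commonNbrs n w t).Nodup :=
  List.nodup_range.filter _

/-- Membership in the clean-up list. [folklore] -/
theorem mem_cleanup_iff (n : ℕ) (w : List Bool) (L W : List ℕ) (k' a : ℕ) :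
    a ∈ cleanup n w L W k' ↔ a < L.length ∧
      3 * k' ≤ 4 * (W.filter fun b => adj n w (L.getD a 0) (L.getD b 0)).length := by
  simp [cleanup]

/-- The clean-up list has no duplicates. [folklore] -/
theorem cleanup_nodup (n : ℕ) (w : List Bool) (L W : List ℕ) (k' : ℕ) :
    (cleanup n w L W k').Nodup :=
  (List.nodup_range).filter _

/-- Semantics of the clique test. [folklore] -/
theorem isClique_eq_true_iff (n : ℕ) (w : List Bool) (C : List ℕ) :
    isClique n w C = true ↔ ∀ a ∈ C, ∀ b ∈ C, a = b ∨ adj n w a b = true := by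
  simp [isClique, List.all_eq_true]

/-! ### The selection of the best candidate -/

/-- Invariant of the selection fold: the result is `init` or a clique candidate, it is at least as
long as `init`, and it is at least as long as every clique candidate. [folklore] -/
theorem foldl_better_spec (n : ℕ) (w : List Bool) :
    ∀ (Cs : List (List ℕ)) (init : List ℕ),
      (Cs.foldl (better n w) init = init ∨
          (Cs.foldl (better n w) init ∈ Cs ∧ isClique n w (Cs.foldl (better n w) init) = true)) ∧
        init.length ≤ (Cs.foldl (better n w) init).length ∧
        ∀ C ∈ Cs, isClique n w C = true → C.length ≤ (Cs.foldl (better n w) init).length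
  | [], init => by simp
  | C :: Cs, init => by
    rw [List.foldl_cons]
    obtain ⟨h1, h2, h3⟩ := foldl_better_spec n w Cs (better n w init C)
    have hb : better n w init C = init ∨ (better n w init C = C ∧ isClique n w C = true) := by
      unfold better
      split_ifs with h
      · rw [Bool.and_eq_true] at h; exact Or.inr ⟨rfl, h.1⟩
      · exact Or.inl rfl
    have hlen : init.length ≤ (better n w init C).length := by
      unfold better
      split_ifs with h
      · rw [Bool.and_eq_true, decide_eq_true_eq] at h; exact h.2.le
      · exact le_rfl
    have hC : isClique n w C = true → C.length ≤ (better n w init C).length := by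
      intro hc
      unfold better
      split_ifs with h
      · exact le_rfl
      · rw [Bool.and_eq_true, decide_eq_true_eq, not_and] at h
        exact not_lt.1 (h hc)
    refine ⟨?_, hlen.trans h2, ?_⟩
    · rcases h1 with h1 | ⟨h1m, h1c⟩
      · rw [h1]
        rcases hb with hb | ⟨hbC, hc⟩
        · exact Or.inl hb
        · exact Or.inr ⟨by rw [hbC]; exact List.mem_cons_self, by rw [hbC]; exact hc⟩
      · exact Or.inr ⟨List.mem_cons_of_mem _ h1m, h1c⟩
    · intro C' hC' hcl
      rcases List.mem_cons.1 hC' with rfl | hC'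
      · exact (hC hcl).trans h2
      · exact h3 C' hC' hcl

/-- **Selection.** If some clique candidate has length `k ≥ 1`, every clique candidate has length
`≤ k`, and every clique candidate of length `k` has vertex set `S₀`, then `best` has vertex set
`S₀`. [cite: AlonKrivelevichSudakov1998, §2.3 (Algorithm B, correctness: "at this iteration we almost surely get the hidden clique")] -/
theorem best_toFinset_eq {n s : ℕ} {w : List Bool} {k : ℕ} (hk : 1 ≤ k) {S₀ : Finset ℕ}
    (hex : ∃ C ∈ candidates n s w, isClique n w C = true ∧ C.length = k)
    (hle : ∀ C ∈ candidates n s w, isClique n w C = true → C.length ≤ k)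
    (heq : ∀ C ∈ candidates n s w, isClique n w C = true → C.length = k → C.toFinset = S₀) :
    (best n s w).toFinset = S₀ := by
  obtain ⟨h1, -, h3⟩ := foldl_better_spec n w (candidates n s w) []
  obtain ⟨C₀, hC₀, hcl₀, hlen₀⟩ := hex
  have hge : k ≤ (best n s w).length := hlen₀ ▸ h3 C₀ hC₀ hcl₀
  rcases h1 with h1 | ⟨hmem, hcl⟩
  · rw [best] at hge; rw [h1] at hge; simp at hge; omega
  · exact heq _ hmem hcl (le_antisymm (hle _ hmem hcl) hge)

/-! ### Decoding the output -/

/-- The output string has length `n`. [folklore] -/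
theorem length_output (s n : ℕ) (w : List Bool) : (output s (n, w)).length = n := by
  simp [output]

/-- The decoded output is the vertex set of `best`. [folklore] -/
theorem decodeVertexSet_output (s n : ℕ) (w : List Bool) :
    decodeVertexSet n (output s (n, w)) =
      Finset.univ.filter fun i : Fin n => (i : ℕ) ∈ best n s w := by
  ext i
  simp only [decodeVertexSet, Finset.mem_filter, Finset.mem_univ, true_and, output]
  rw [List.getD_eq_getElem _ _ (by simp [i.isLt])]
  simp

/-! ### The selection of the `k'` largest coordinates -/

/-- `keyLE` is the order `(-|v|, position) ≤ (-|v'|, position')` of the lexicographic linear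
order `ℤ ×ₗ ℕ`. [folklore] -/
theorem keyLE_eq_true_iff (p q : ℤ × ℕ) :
    keyLE p q = true ↔ toLex (-p.1, p.2) ≤ toLex (-q.1, q.2) := by
  simp only [keyLE, Bool.or_eq_true, decide_eq_true_eq, Bool.and_eq_true,
    Prod.Lex.toLex_le_toLex, neg_lt_neg_iff, neg_inj]

/-- The sorted key list is a permutation of the keys and is sorted for `keyLE`. [folklore] -/
theorem insertionSort_keys_pairwise (l : List (ℤ × ℕ)) :
    (l.insertionSort fun p q => keyLE p q = true).Pairwise fun p q => keyLE p q = true := by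
  have htot : Std.Total fun p q : ℤ × ℕ => keyLE p q = true :=
    ⟨fun p q => by simp only [keyLE_eq_true_iff]; exact le_total _ _⟩
  have htrans : IsTrans (ℤ × ℕ) fun p q => keyLE p q = true :=
    ⟨fun p q u h1 h2 => by rw [keyLE_eq_true_iff] at h1 h2 ⊢; exact h1.trans h2⟩
  exact List.pairwise_insertionSort _ l

/-- The key list of `topPositions`: `(|y a|, a)` for the positions `a < |y|`. [folklore] -/
theorem mapIdx_keys_eq (y : List ℤ) :
    (y.mapIdx fun a v => (|v|, a)) = (List.range y.length).map fun a => (|y.getD a 0|, a) := by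
  apply List.ext_getElem
  · simp
  · intro i h1 h2
    rw [List.getElem_mapIdx, List.getElem_map, List.getElem_range]
    simp only [List.length_mapIdx] at h1
    rw [List.getD_eq_getElem _ _ h1]

/-- The key list has distinct entries. [folklore] -/
theorem keys_nodup (y : List ℤ) :
    ((List.range y.length).map fun a => (|y.getD a 0|, a)).Nodup :=
  (List.nodup_range).map fun _ _ h => (Prod.mk.injEq _ _ _ _ ▸ h).2

/-- **The selected positions**: for `k' ≤ |y|`, `topPositions y k'` lists `k'` distinct positions
`< |y|`. [cite: AlonKrivelevichSudakov1998, §2.1 (Algorithm A, step 2)] -/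
theorem topPositions_spec (y : List ℤ) {k' : ℕ} (hk : k' ≤ y.length) :
    (topPositions y k').length = k' ∧ (topPositions y k').Nodup ∧
      ∀ a ∈ topPositions y k', a < y.length := by
  set keys := (List.range y.length).map fun a => (|y.getD a 0|, a) with hkeys
  set srt := keys.insertionSort fun p q => keyLE p q = true with hsrt
  have hperm : srt.Perm keys := List.perm_insertionSort _ keys
  have hlen : srt.length = y.length := by rw [hperm.length_eq, hkeys]; simp
  rw [topPositions, mapIdx_keys_eq, ← hkeys, ← hsrt]
  refine ⟨?_, ?_, ?_⟩
  · rw [List.length_map, List.length_take, hlen, min_eq_left hk]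
  · have hnd : srt.Nodup := hperm.nodup_iff.2 (keys_nodup y)
    refine (hnd.sublist (List.take_sublist _ _)).map_on ?_
    intro p hp q hq hpq
    have hp' : p ∈ keys := hperm.subset (List.mem_of_mem_take hp)
    have hq' : q ∈ keys := hperm.subset (List.mem_of_mem_take hq)
    simp only [hkeys, List.mem_map, List.mem_range] at hp' hq'
    obtain ⟨a, -, rfl⟩ := hp'
    obtain ⟨b, -, rfl⟩ := hq'
    simp only at hpq
    rw [hpq]
  · intro a ha
    rw [List.mem_map] at ha
    obtain ⟨p, hp, rfl⟩ := ha
    have hp' : p ∈ keys := hperm.subset (List.mem_of_mem_take hp)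
    simp only [hkeys, List.mem_map, List.mem_range] at hp'
    obtain ⟨b, hb, rfl⟩ := hp'
    exact hb

/-- **Domination**: a selected position beats every unselected position in absolute value.
[cite: AlonKrivelevichSudakov1998, §2.1 (Algorithm A, step 2: "the `k` largest coordinates")] -/
theorem abs_le_of_mem_topPositions (y : List ℤ) {k' : ℕ} {a b : ℕ}
    (ha : a ∈ topPositions y k') (hb : b < y.length) (hbW : b ∉ topPositions y k') :
    |y.getD b 0| ≤ |y.getD a 0| := by
  set keys := (List.range y.length).map fun a => (|y.getD a 0|, a) with hkeys
  set srt := keys.insertionSort fun p q => keyLE p q = true with hsrt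
  have hperm : srt.Perm keys := List.perm_insertionSort _ keys
  have hsorted : srt.Pairwise fun p q => keyLE p q = true := insertionSort_keys_pairwise keys
  rw [topPositions, mapIdx_keys_eq, ← hkeys, ← hsrt] at ha hbW
  -- the key of `a` is among the first `k'` sorted keys, the key of `b` among the rest
  rw [List.mem_map] at ha
  obtain ⟨p, hp, rfl⟩ := ha
  have hpkeys : p ∈ keys := hperm.subset (List.mem_of_mem_take hp)
  have hp1 : p.1 = |y.getD p.2 0| := by
    simp only [hkeys, List.mem_map, List.mem_range] at hpkeys
    obtain ⟨c, -, rfl⟩ := hpkeys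
    rfl
  have hbkey : (|y.getD b 0|, b) ∈ srt := by
    refine hperm.symm.subset ?_
    simp only [hkeys, List.mem_map, List.mem_range]
    exact ⟨b, hb, rfl⟩
  have hbdrop : (|y.getD b 0|, b) ∈ srt.drop k' := by
    rw [← List.take_append_drop k' srt, List.mem_append] at hbkey
    rcases hbkey with h | h
    · exact absurd (List.mem_map.2 ⟨_, h, rfl⟩) hbW
    · exact h
  have hle : keyLE p (|y.getD b 0|, b) = true := by
    rw [← List.take_append_drop k' srt, List.pairwise_append] at hsorted
    exact hsorted.2.2 p hp _ hbdrop
  rw [keyLE_eq_true_iff, Prod.Lex.toLex_le_toLex, hp1] at hle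
  simp only [neg_lt_neg_iff, neg_inj] at hle
  rcases hle with h | ⟨h, -⟩
  · exact h.le
  · exact h.ge

end AKSProg

end Literature.Probability.RandomGraphs.PlantedClique
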